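import Mathlib
import Summits.ValiantsHypothesis.ValiantsHypothesis.Theorems.GrenetZeonTwoDimCoefficientsStubClassify
import Summits.ValiantsHypothesis.ValiantsHypothesis.Theorems.GrenetZeonTwoDimCoefficientsDualUnipotentTraceConstraints

/-!
# Crux `GrenetZeon.TwoDimCoefficients` (stmt-ValiantsHypothesis-8062), stub `stub_dualUnipotent`, and rung
# `GrenetZeon.DualUnipotentThreeHalves` (stmt-ValiantsHypothesis-24318): the DUAL CAYLEY–HAMILTON COUPLING of the
# nilpotent pencil `N` and its direction `M`

The unipotent dual model of `per_n` has the constrained normal form (✓ `exists_constrained_pencil_of_dualUnipotentRepr`,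
`…DualUnipotentTraceConstraints`): linear `m × m` pencils `N`, `M` with `N ^ m = 0`, `per_n = tr(N^{n-1} M)` and
`tr(N^j M) = 0` for `j ≠ n - 1`.  The `slow_core` / (c) programme on 24318 works with `N` alone.  This file records the
exact ALGEBRAIC COUPLING between `N` and `M` that the trace constraints encode, obtained from the Cayley–Hamilton theorem for
the matrix `N + ε M` over the dual numbers `R[ε]`:

* `charpoly_dualLift` — for `L : Matrix ι ι R` with `charpoly L = X^m` (`m = card ι`; e.g. `L` nilpotent over a reduced ring,
  `charpoly_eq_X_pow_of_pow_eq_zero`) and ANY `M`, the characteristic polynomial of `L + εM ∈ M_m(R[ε])` is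
  `X^m − Σ_{i<m} (ε·tr(L^{m-1-i} M))·X^i` (Jacobi's first-order formula ✓ `det_add_smul_of_mul_self_eq_zero` at the
  characteristic matrix, whose adjugate is the truncated resolvent `Σ_i X^i L^{m-1-i}`, `adjugate_charmatrix_eq`).
* ★ `powDeriv_card_eq` — **first-order Cayley–Hamilton for nilpotents**: `Σ_{i<m} L^i M L^{m-1-i} = Σ_{i<m} tr(L^{m-1-i} M) • L^i`
  (the `ε`-component of `χ(L + εM)(L + εM) = 0`; `Σ_{i<k} L^i M L^{k-1-i}` is the `ε`-part of `(L + εM)^k`,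
  `dualLift_pow_map_snd`).
* ★★ `powDeriv_card_eq_trace_smul_pow` — under the trace constraints `tr(L^j M) = 0` (`j < m`, `j ≠ n − 1`), `1 ≤ n ≤ m`:
  `Σ_{i<m} L^i M L^{m-1-i} = tr(L^{n-1} M) • L^{m-n}` — a MATRIX identity (`m²` scalar identities per point), of which the
  trace constraints are the shadow.
* ★★ `exists_coupled_pencil_of_dualUnipotentRepr` — in the unipotent dual model of `per_n` (`DualUnipotentRepr n m`, `n ≥ 1`):
  the constrained pencil satisfies `n ≤ m` and `Σ_{i<m} N^i M N^{m-1-i} = per_n • N^{m-n}` as polynomial matrices; so `per_n`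
  divides every entry of the symmetrised product, and the symmetrised product vanishes when `N^{m-n} = 0`
  (`powDeriv_eq_zero_of_pow_eq_zero`).

HONEST FRAMING: a structural identity (support lemma, `--supports stmt-ValiantsHypothesis-8062`); it closes no stub:
`stub_dualUnipotent` (`DualUnipotentBound`), (c) `SlowCore.LongMassSlowLawInv`, the rung 24318, the crux 8062 and `VP ≠ VNP` stay
OPEN / NOT proved.  No sorry, no definitions, no instances, no notation, no named facts.
[folklore: Cayley–Hamilton over `R[ε]`; Jacobi's formula]
-/

set_option linter.dupNamespace false
set_option autoImplicit false

noncomputable section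

namespace Summit.ValiantsHypothesis.ValiantsHypothesis.Cruxes.TwoDimCoefficients.DimTwoCases.DualCharpoly

open Matrix Polynomial TrivSqZeroExt
open scoped BigOperators

/-! ## §1 Matrices over the dual numbers: first-order parts of products and powers -/

section Parts

variable {ι : Type*} {R : Type*} [CommRing R]

/-- Scalars `inr t = t·ε` act on `ε`-parts through the `ε`-free part. -/
theorem smul_map_snd_inr (t : R) (P : Matrix ι ι (DualNumber R)) :
    ((inr t : DualNumber R) • P).map (snd : DualNumber R → R) = t • P.map fst := by
  ext i j
  simp [mul_comm]

/-- `ε`-free part of the lift. -/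
@[simp] theorem dualLift_map_fst (L M : Matrix ι ι R) :
    (L.map inl + M.map inr : Matrix ι ι (DualNumber R)).map (fst : DualNumber R → R) = L := by
  ext i j; simp

/-- `ε`-part of the lift. -/
@[simp] theorem dualLift_map_snd (L M : Matrix ι ι R) :
    (L.map inl + M.map inr : Matrix ι ι (DualNumber R)).map (snd : DualNumber R → R) = M := by
  ext i j; simp

variable [Fintype ι]

/-- `ε`-free parts multiply. -/
theorem mul_map_fst (P Q : Matrix ι ι (DualNumber R)) :
    (P * Q).map (fst : DualNumber R → R) = P.map fst * Q.map fst := by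
  ext i j
  simp [Matrix.mul_apply, fst_sum]

/-- Leibniz rule for the `ε`-parts of a product. -/
theorem mul_map_snd (P Q : Matrix ι ι (DualNumber R)) :
    (P * Q).map (snd : DualNumber R → R) = P.map fst * Q.map snd + P.map snd * Q.map fst := by
  ext i j
  simp [Matrix.mul_apply, snd_sum, Finset.sum_add_distrib, mul_comm]

variable [DecidableEq ι]

/-- The recursion of the first-order parts of powers. -/
theorem powDeriv_succ (L M : Matrix ι ι R) (k : ℕ) :
    (∑ i ∈ Finset.range (k + 1), L ^ i * M * L ^ (k + 1 - 1 - i)) =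
      L ^ k * M + (∑ i ∈ Finset.range k, L ^ i * M * L ^ (k - 1 - i)) * L := by
  rw [Finset.sum_range_succ, Finset.sum_mul, add_comm]
  congr 1
  · simp
  · refine Finset.sum_congr rfl fun i hi => ?_
    have hik : k + 1 - 1 - i = (k - 1 - i) + 1 := by
      have := Finset.mem_range.mp hi; omega
    simp only [hik, pow_succ, Matrix.mul_assoc]

/-- If `L ^ h = 0` then `Σ_{i<k} L^i M L^{k-1-i} = 0` for `2h ≤ k` (every word `L^i M L^{k-1-i}` has a factor
`L^a` with `a ≥ h`). -/
theorem powDeriv_eq_zero_of_pow_eq_zero (L M : Matrix ι ι R) {h k : ℕ} (hL : L ^ h = 0) (hk : 2 * h ≤ k) :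
    (∑ i ∈ Finset.range k, L ^ i * M * L ^ (k - 1 - i)) = 0 := by
  refine Finset.sum_eq_zero fun i hi => ?_
  have him := Finset.mem_range.mp hi
  by_cases hih : h ≤ i
  · rw [← Nat.add_sub_cancel' hih, pow_add, hL, Matrix.zero_mul, Matrix.zero_mul, Matrix.zero_mul]
  · have hkh : h ≤ k - 1 - i := by omega
    rw [← Nat.add_sub_cancel' hkh, pow_add, hL, Matrix.zero_mul, Matrix.mul_zero]

/-- `ε`-free part of `(L + εM)^k` is `L^k`. -/
theorem dualLift_pow_map_fst (L M : Matrix ι ι R) (k : ℕ) :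
    ((L.map inl + M.map inr : Matrix ι ι (DualNumber R)) ^ k).map (fst : DualNumber R → R) = L ^ k := by
  induction k with
  | zero =>
    ext i j
    simp only [pow_zero, Matrix.map_apply, Matrix.one_apply]
    split_ifs <;> simp
  | succ k ih => rw [pow_succ, mul_map_fst, ih, dualLift_map_fst, pow_succ]

/-- `ε`-part of `(L + εM)^k` is `Σ_{i<k} L^i M L^{k-1-i}`. -/
theorem dualLift_pow_map_snd (L M : Matrix ι ι R) (k : ℕ) :
    ((L.map inl + M.map inr : Matrix ι ι (DualNumber R)) ^ k).map (snd : DualNumber R → R) = (∑ i ∈ Finset.range k, L ^ i * M * L ^ (k - 1 - i)) := by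
  induction k with
  | zero =>
    ext i j
    simp only [pow_zero, Matrix.map_apply, Matrix.one_apply, Finset.range_zero, Finset.sum_empty,
      Matrix.zero_apply]
    split_ifs <;> simp
  | succ k ih =>
    rw [pow_succ, mul_map_snd, ih, dualLift_map_fst, dualLift_map_snd, dualLift_pow_map_fst, powDeriv_succ]

end Parts

/-! ## §2 The characteristic polynomial of `L + εM` -/

section Charpoly

variable {ι : Type*} [Fintype ι] [DecidableEq ι] {R : Type*} [CommRing R]

/-- `charpoly L = X^m` forces `L^m = 0` (Cayley–Hamilton). -/
theorem pow_card_eq_zero_of_charpoly (L : Matrix ι ι R) (hL : L.charpoly = X ^ Fintype.card ι) :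
    L ^ Fintype.card ι = 0 := by
  have h := Matrix.aeval_self_charpoly L
  rwa [hL, map_pow, aeval_X] at h

/-- Over a reduced commutative ring a nilpotent matrix has characteristic polynomial `X^m`. -/
theorem charpoly_eq_X_pow_of_pow_eq_zero [IsReduced R] (L : Matrix ι ι R) {k : ℕ} (hL : L ^ k = 0) :
    L.charpoly = X ^ Fintype.card ι := by
  have h := Matrix.isNilpotent_charpoly_sub_pow_of_isNilpotent (M := L) ⟨k, hL⟩
  rw [Polynomial.isNilpotent_iff] at h
  rw [← sub_eq_zero]
  ext i
  rw [coeff_zero]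
  exact (h i).eq_zero

/-- **The adjugate of the characteristic matrix of a matrix with `charpoly = X^m`** is the truncated resolvent
`Σ_{i<m} X^i · L^{m-1-i}`. -/
theorem adjugate_charmatrix_eq (L : Matrix ι ι R) (hL : L.charpoly = X ^ Fintype.card ι) :
    adjugate (charmatrix L) =
      ∑ i ∈ Finset.range (Fintype.card ι),
        (Matrix.scalar ι (X : R[X])) ^ i * ((C : R →+* R[X]).mapMatrix L) ^ (Fintype.card ι - 1 - i) := by
  set m := Fintype.card ι with hm
  set x : Matrix ι ι R[X] := Matrix.scalar ι (X : R[X]) with hx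
  set y : Matrix ι ι R[X] := (C : R →+* R[X]).mapMatrix L with hy
  set G : Matrix ι ι R[X] := ∑ i ∈ Finset.range m, x ^ i * y ^ (m - 1 - i) with hG
  have hchar : charmatrix L = x - y := rfl
  have hcomm : Commute x y := Matrix.scalar_commute X (fun r' => Commute.all _ _) y
  have hym : y ^ m = 0 := by
    rw [hy, ← map_pow, pow_card_eq_zero_of_charpoly L hL, map_zero]
  have hxm : x ^ m = (X ^ m : R[X]) • (1 : Matrix ι ι R[X]) := by
    rw [hx, ← map_pow, Matrix.scalar_apply, Matrix.smul_one_eq_diagonal]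
  -- `(x - y) * G = x^m - y^m = X^m • 1`
  have hmul : (x - y) * G = (X ^ m : R[X]) • (1 : Matrix ι ι R[X]) := by
    rw [hG, hcomm.mul_geom_sum₂ m, hym, sub_zero, hxm]
  -- multiply by the adjugate on the left
  have hdet : (x - y).det = X ^ m := by rw [← hchar]; exact hL
  have h1 : adjugate (x - y) * ((x - y) * G) = (X ^ m : R[X]) • G := by
    rw [← Matrix.mul_assoc, adjugate_mul, hdet, Matrix.smul_mul, Matrix.one_mul]
  have h2 : adjugate (x - y) * ((x - y) * G) = (X ^ m : R[X]) • adjugate (x - y) := by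
    rw [hmul, Matrix.mul_smul, Matrix.mul_one]
  have h12 : (X ^ m : R[X]) • adjugate (x - y) = (X ^ m : R[X]) • G := h2.symm.trans h1
  rw [hchar]
  refine Matrix.ext fun i j => ?_
  have hij := congr_fun (congr_fun h12 i) j
  simp only [Matrix.smul_apply, smul_eq_mul] at hij
  exact (isRegular_X_pow m).left hij

/-- `ε · inl t = inr t` in `R[ε]`. -/
theorem eps_mul_inl (t : R) : (DualNumber.eps : DualNumber R) * inl t = inr t := by
  rw [DualNumber.eps, inr_mul_inl, op_smul_eq_mul, one_mul]

/-- Traces of doubly mapped matrices. -/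
theorem trace_mapMatrix_C_inl (A : Matrix ι ι R) :
    ((C : DualNumber R →+* (DualNumber R)[X]).mapMatrix ((inlHom R R).mapMatrix A)).trace =
      C (inl A.trace : DualNumber R) := by
  simp only [Matrix.trace, Matrix.diag_apply, RingHom.mapMatrix_apply, Matrix.map_apply]
  rw [← map_sum, ← map_sum]
  rfl

/-- **The characteristic polynomial of `L + εM`** for `charpoly L = X^m`:
`χ(L + εM) = X^m − Σ_{i<m} (ε·tr(L^{m-1-i} M))·X^i`. -/
theorem charpoly_dualLift (L M : Matrix ι ι R) (hL : L.charpoly = X ^ Fintype.card ι) :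
    (L.map inl + M.map inr : Matrix ι ι (DualNumber R)).charpoly = X ^ Fintype.card ι -
      ∑ i ∈ Finset.range (Fintype.card ι),
        C (inr ((L ^ (Fintype.card ι - 1 - i) * M).trace) : DualNumber R) * X ^ i := by
  set m := Fintype.card ι with hm
  set e : (DualNumber R)[X] := C (DualNumber.eps : DualNumber R) with he
  have hee : e * e = 0 := by rw [he, ← map_mul, DualNumber.eps_mul_eps, map_zero]
  set L' : Matrix ι ι (DualNumber R) := (inlHom R R).mapMatrix L with hL'
  set M' : Matrix ι ι (DualNumber R) := (inlHom R R).mapMatrix M with hM'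
  set B : Matrix ι ι (DualNumber R)[X] := -((C : DualNumber R →+* (DualNumber R)[X]).mapMatrix M') with hB
  -- the characteristic matrix of the lift is a first-order perturbation of that of `L'`
  have hcm : charmatrix (L.map inl + M.map inr : Matrix ι ι (DualNumber R)) = charmatrix L' + e • B := by
    refine Matrix.ext fun i j => ?_
    simp only [charmatrix_apply, Matrix.add_apply, Matrix.map_apply, Matrix.smul_apply, hB, hL', hM',
      Matrix.neg_apply, RingHom.mapMatrix_apply, inlHom_apply, smul_eq_mul, he]
    rw [map_add, ← eps_mul_inl (M i j), map_mul]
    ring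
  -- charpoly of `L'`
  have hL'char : L'.charpoly = X ^ m := by
    rw [hL', RingHom.mapMatrix_apply, Matrix.charpoly_map, hL, Polynomial.map_pow, Polynomial.map_X]
  -- Jacobi's formula to first order
  have hdet : (L.map inl + M.map inr : Matrix ι ι (DualNumber R)).charpoly = X ^ m + e * (adjugate (charmatrix L') * B).trace := by
    rw [Matrix.charpoly, hcm, det_add_smul_of_mul_self_eq_zero hee, ← Matrix.charpoly, hL'char]
  -- the terms of the truncated resolvent against `B`
  have hterm : ∀ i ∈ Finset.range m,
      e * ((Matrix.scalar ι (X : (DualNumber R)[X])) ^ i *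
        ((C : DualNumber R →+* (DualNumber R)[X]).mapMatrix L') ^ (m - 1 - i) * B).trace =
      -(C (inr ((L ^ (m - 1 - i) * M).trace) : DualNumber R) * X ^ i) := by
    intro i _
    have hprod : ((C : DualNumber R →+* (DualNumber R)[X]).mapMatrix L') ^ (m - 1 - i) * B =
        -((C : DualNumber R →+* (DualNumber R)[X]).mapMatrix ((inlHom R R).mapMatrix (L ^ (m - 1 - i) * M))) := by
      rw [hB, Matrix.mul_neg, ← map_pow, ← map_mul, hL', hM', ← map_pow, ← map_mul]
    rw [Matrix.mul_assoc, hprod, ← map_pow, Matrix.scalar_apply, ← smul_eq_diagonal_mul, Matrix.trace_smul,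
      Matrix.trace_neg, trace_mapMatrix_C_inl, smul_eq_mul, he]
    have hC : (C (DualNumber.eps : DualNumber R) : (DualNumber R)[X]) *
        C (inl ((L ^ (m - 1 - i) * M).trace) : DualNumber R) = C (inr ((L ^ (m - 1 - i) * M).trace) : DualNumber R) := by
      rw [← map_mul, eps_mul_inl]
    rw [← hC]
    ring
  rw [hdet, adjugate_charmatrix_eq L' hL'char, Finset.sum_mul, Matrix.trace_sum, Finset.mul_sum,
    Finset.sum_congr rfl hterm, Finset.sum_neg_distrib, ← sub_eq_add_neg]

/-! ## §3 First-order Cayley–Hamilton: the coupling identities -/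

/-- ★ **First-order Cayley–Hamilton for nilpotents.**  If `charpoly L = X^m` then for every `M`,
`Σ_{i<m} L^i M L^{m-1-i} = Σ_{i<m} tr(L^{m-1-i} M) • L^i`. -/
theorem powDeriv_card_eq (L M : Matrix ι ι R) (hL : L.charpoly = X ^ Fintype.card ι) :
    (∑ i ∈ Finset.range (Fintype.card ι), L ^ i * M * L ^ (Fintype.card ι - 1 - i)) =
      ∑ i ∈ Finset.range (Fintype.card ι), ((L ^ (Fintype.card ι - 1 - i) * M).trace) • L ^ i := by
  set m := Fintype.card ι with hm
  have hCH := Matrix.aeval_self_charpoly (L.map inl + M.map inr : Matrix ι ι (DualNumber R))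
  rw [charpoly_dualLift L M hL, map_sub, map_pow, aeval_X, map_sum, sub_eq_zero] at hCH
  simp only [map_mul, map_pow, aeval_X, aeval_C, Algebra.algebraMap_eq_smul_one, Matrix.smul_mul,
    Matrix.one_mul] at hCH
  have h := congr_arg (fun P : Matrix ι ι (DualNumber R) => P.map (snd : DualNumber R → R)) hCH
  simp only [dualLift_pow_map_snd] at h
  rw [h]
  have hs : (∑ x ∈ Finset.range m, (inr ((L ^ (m - 1 - x) * M).trace) : DualNumber R) • (L.map inl + M.map inr : Matrix ι ι (DualNumber R)) ^ x).map
      (snd : DualNumber R → R) =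
      ∑ x ∈ Finset.range m, ((inr ((L ^ (m - 1 - x) * M).trace) : DualNumber R) • (L.map inl + M.map inr : Matrix ι ι (DualNumber R)) ^ x).map
        (snd : DualNumber R → R) := by
    ext i j
    simp only [Matrix.map_apply, Matrix.sum_apply, snd_sum]
  rw [hs]
  exact Finset.sum_congr rfl fun i _ => by rw [smul_map_snd_inr, dualLift_pow_map_fst]

/-- ★★ **The coupling identity under the trace constraints.**  If `charpoly L = X^m`, `1 ≤ n ≤ m` and
`tr(L^j M) = 0` for every `j < m`, `j ≠ n - 1`, then `Σ_{i<m} L^i M L^{m-1-i} = tr(L^{n-1} M) • L^{m-n}`. -/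
theorem powDeriv_card_eq_trace_smul_pow (L M : Matrix ι ι R) (hL : L.charpoly = X ^ Fintype.card ι) {n : ℕ}
    (hn : 1 ≤ n) (hnm : n ≤ Fintype.card ι)
    (htr : ∀ j : ℕ, j < Fintype.card ι → j ≠ n - 1 → (L ^ j * M).trace = 0) :
    (∑ i ∈ Finset.range (Fintype.card ι), L ^ i * M * L ^ (Fintype.card ι - 1 - i)) = ((L ^ (n - 1) * M).trace) • L ^ (Fintype.card ι - n) := by
  set m := Fintype.card ι with hm
  rw [powDeriv_card_eq L M hL, Finset.sum_eq_single (m - n)]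
  · have : m - 1 - (m - n) = n - 1 := by omega
    rw [this]
  · intro i hi hne
    have him := Finset.mem_range.mp hi
    rw [htr (m - 1 - i) (by omega) (by omega), zero_smul]
  · intro h
    exact absurd (Finset.mem_range.mpr (by omega)) h

end Charpoly

/-! ## §4 The unipotent dual model of `per_n`: `Σ_i N^i M N^{m-1-i} = per_n • N^{m-n}` -/

section Model

open Literature.Computability.AlgebraicComplexity

/-- ★★ **The coupled normal form of a unipotent dual representation of `per_n`.**  If `DualUnipotentRepr n m`
(`n ≥ 1`) then there are LINEAR pencils `N`, `M` with `N ^ m = 0`, `per_n = tr(N^{n-1} M)`, `tr(N^j M) = 0`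
(`j ≠ n - 1`), `n ≤ m`, and the MATRIX identity `Σ_{i<m} N^i · M · N^{m-1-i} = per_n • N^{m-n}`. -/
theorem exists_coupled_pencil_of_dualUnipotentRepr {n m : ℕ} (hn : 1 ≤ n) (h : DualUnipotentRepr n m) :
    ∃ N M : AffMat n m, (∀ i j, (N i j).IsHomogeneous 1) ∧ (∀ i j, (M i j).IsHomogeneous 1) ∧
      N ^ m = 0 ∧ perPoly (Fin n) ℂ = (N ^ (n - 1) * M).trace ∧
      (∀ j : ℕ, j ≠ n - 1 → (N ^ j * M).trace = 0) ∧ n ≤ m ∧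
      ∑ i ∈ Finset.range m, N ^ i * M * N ^ (m - 1 - i) = perPoly (Fin n) ℂ • N ^ (m - n) := by
  obtain ⟨N, M, hN, hM, hnil, hper, htr⟩ := exists_constrained_pencil_of_dualUnipotentRepr hn h
  -- `n ≤ m`: otherwise `N^{n-1} = 0` and `per_n = 0`
  have hnm : n ≤ m := by
    by_contra hlt
    have hpow : N ^ (n - 1) = 0 := by
      rw [← Nat.add_sub_cancel' (show m ≤ n - 1 by omega), pow_add, hnil, Matrix.zero_mul]
    have : perPoly (Fin n) ℂ = 0 := by rw [hper, hpow, Matrix.zero_mul, Matrix.trace_zero]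
    exact perPoly_ne_zero (Fin n) ℂ this
  have hchar : N.charpoly = X ^ Fintype.card (Fin m) := charpoly_eq_X_pow_of_pow_eq_zero N hnil
  refine ⟨N, M, hN, hM, hnil, hper, htr, hnm, ?_⟩
  have hcoup := powDeriv_card_eq_trace_smul_pow N M hchar hn (by rwa [Fintype.card_fin])
    (fun j _ hj => htr j hj)
  simp only [Fintype.card_fin] at hcoup
  rw [hcoup, ← hper]

/-- Corollary: in the coupled normal form, if moreover `N ^ (m - n) = 0` (a SHORT pencil) then the symmetrised
product `Σ_{i<m} N^i · M · N^{m-1-i}` vanishes identically. -/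
theorem powDeriv_pencil_eq_zero_of_short {n m : ℕ} (N M : AffMat n m)
    (hcoup : ∑ i ∈ Finset.range m, N ^ i * M * N ^ (m - 1 - i) = perPoly (Fin n) ℂ • N ^ (m - n))
    (hshort : N ^ (m - n) = 0) :
    ∑ i ∈ Finset.range m, N ^ i * M * N ^ (m - 1 - i) = 0 := by
  rw [hcoup, hshort, smul_zero]

end Model

/-! ## §5 SHORT POINTS OF THE PENCIL ARE PERMANENTAL ZEROS (pointwise reading of the coupling; appended)

At a point `x` where the VALUE `N(x)` is SHORT — `N(x)^h = 0` with `2h ≤ m` — every word `N(x)^i M(x) N(x)^{m-1-i}` dies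
(`powDeriv_eq_zero_of_pow_eq_zero`), so the coupling identity evaluates to `per_n(x) • N(x)^{m-n} = 0`
(`eval_perPoly_smul_pow_eq_zero_of_short`); hence **either `N(x)^{m-n} = 0` or `per_n(x) = 0`** (`eval_perPoly_eq_zero_of_short`,
packaged from the representation in ★ `short_points_subset_zeros_of_dualUnipotentRepr`).  Reading for the `slow_core` / (c)
programme on 24318, which prices POINTWISE-SHORT mass by absorption: in the regime `m < 2n` the locus
`{x : N(x)^{⌊m/2⌋} = 0, N(x)^{m-n} ≠ 0}` of short-but-not-too-short values of the pencil lies on the permanental hypersurface.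
Honest framing unchanged: helper; no stub closes. -/

section ShortPoints

open Literature.Computability.AlgebraicComplexity

variable {n m : ℕ}

/-- Evaluating the symmetrised product entrywise. -/
theorem map_eval_sum_pow_mul (N M : AffMat n m) (x : Fin n × Fin n → ℂ) :
    (∑ i ∈ Finset.range m, N ^ i * M * N ^ (m - 1 - i)).map (MvPolynomial.eval x) =
      ∑ i ∈ Finset.range m, (N.map (MvPolynomial.eval x)) ^ i * M.map (MvPolynomial.eval x) * (N.map (MvPolynomial.eval x)) ^ (m - 1 - i) := by
  rw [← RingHom.mapMatrix_apply, map_sum]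
  simp only [map_mul, map_pow, RingHom.mapMatrix_apply]

/-- **Short values kill `per_n • N^{m-n}`.**  If `Σ_{i<m} N^i M N^{m-1-i} = per_n • N^{m-n}` and the value `N(x)` satisfies
`N(x)^h = 0` with `2h ≤ m`, then `per_n(x) • N(x)^{m-n} = 0`. -/
theorem eval_perPoly_smul_pow_eq_zero_of_short (N M : AffMat n m)
    (hcoup : ∑ i ∈ Finset.range m, N ^ i * M * N ^ (m - 1 - i) = perPoly (Fin n) ℂ • N ^ (m - n))
    (x : Fin n × Fin n → ℂ) {h : ℕ} (h2 : 2 * h ≤ m) (hx : (N.map (MvPolynomial.eval x)) ^ h = 0) :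
    MvPolynomial.eval x (perPoly (Fin n) ℂ) • (N.map (MvPolynomial.eval x)) ^ (m - n) = 0 := by
  have h0 := powDeriv_eq_zero_of_pow_eq_zero (N.map (MvPolynomial.eval x)) (M.map (MvPolynomial.eval x)) hx h2
  rw [← map_eval_sum_pow_mul, hcoup] at h0
  have hp : (N.map (MvPolynomial.eval x)) ^ (m - n) = (N ^ (m - n)).map (MvPolynomial.eval x) := by
    rw [← RingHom.mapMatrix_apply, ← RingHom.mapMatrix_apply, map_pow]
  have hsm : (perPoly (Fin n) ℂ • N ^ (m - n)).map (MvPolynomial.eval x) =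
      MvPolynomial.eval x (perPoly (Fin n) ℂ) • (N.map (MvPolynomial.eval x)) ^ (m - n) := by
    rw [hp]
    ext i j
    simp [Matrix.smul_apply]
  rwa [hsm] at h0

/-- **Short points are permanental zeros.**  Under the coupling identity, if `N(x)^h = 0` with `2h ≤ m` but
`N(x)^{m-n} ≠ 0`, then `per_n(x) = 0`. -/
theorem eval_perPoly_eq_zero_of_short (N M : AffMat n m)
    (hcoup : ∑ i ∈ Finset.range m, N ^ i * M * N ^ (m - 1 - i) = perPoly (Fin n) ℂ • N ^ (m - n))
    (x : Fin n × Fin n → ℂ) {h : ℕ} (h2 : 2 * h ≤ m) (hx : (N.map (MvPolynomial.eval x)) ^ h = 0)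
    (hne : (N.map (MvPolynomial.eval x)) ^ (m - n) ≠ 0) : MvPolynomial.eval x (perPoly (Fin n) ℂ) = 0 := by
  rcases smul_eq_zero.mp (eval_perPoly_smul_pow_eq_zero_of_short N M hcoup x h2 hx) with h0 | h0
  · exact h0
  · exact absurd h0 hne

/-- ★ **Packaged form.**  Every unipotent dual representation of `per_n` (`n ≥ 1`) has a constrained linear pencil `(N, M)`
(`N^m = 0`, `per_n = tr(N^{n-1} M)`, `n ≤ m`) whose SHORT-BUT-LONG values are permanental zeros:
`N(x)^h = 0`, `2h ≤ m`, `N(x)^{m-n} ≠ 0 ⇒ per_n(x) = 0`. -/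
theorem short_points_subset_zeros_of_dualUnipotentRepr (hn : 1 ≤ n) (hrep : DualUnipotentRepr n m) :
    ∃ N M : AffMat n m, (∀ i j, (N i j).IsHomogeneous 1) ∧ (∀ i j, (M i j).IsHomogeneous 1) ∧
      N ^ m = 0 ∧ perPoly (Fin n) ℂ = (N ^ (n - 1) * M).trace ∧ n ≤ m ∧
      ∀ (x : Fin n × Fin n → ℂ) (h : ℕ), 2 * h ≤ m → (N.map (MvPolynomial.eval x)) ^ h = 0 →
        (N.map (MvPolynomial.eval x)) ^ (m - n) ≠ 0 → MvPolynomial.eval x (perPoly (Fin n) ℂ) = 0 := by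
  obtain ⟨N, M, hN, hM, hnil, hper, -, hnm, hcoup⟩ := exists_coupled_pencil_of_dualUnipotentRepr hn hrep
  exact ⟨N, M, hN, hM, hnil, hper, hnm, fun x _ h2 hx hne => eval_perPoly_eq_zero_of_short N M hcoup x h2 hx hne⟩

end ShortPoints

end Summit.ValiantsHypothesis.ValiantsHypothesis.Cruxes.TwoDimCoefficients.DimTwoCases.DualCharpoly

end
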